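import Summits.ResolutionOfSingularities.ResolutionOfSingularities.Theorems.PurelyInseparableDim4ResConePairVirtualChain
import Summits.ResolutionOfSingularities.ResolutionOfSingularities.Theorems.PurelyInseparableDim4ResConeDInfTT
import Summits.ResolutionOfSingularities.ResolutionOfSingularities.Theorems.PurelyInseparableDim4ResConePrimeWeights
import Summits.ResolutionOfSingularities.ResolutionOfSingularities.Theorems.PurelyInseparableDim4PairVirtualStep
import Summits.ResolutionOfSingularities.ResolutionOfSingularities.Theorems.PurelyInseparableDim4ResConeSatellitePair
import Summits.ResolutionOfSingularities.ResolutionOfSingularities.Theorems.PurelyInseparableDim4TschirnhausChain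
import HarnessLib
import HarnessLib.Audit.Tags

/-!
# Purely inseparable four-folds — THE LIGHT-PAIR `e_G = 2` TAIL IS EMPTY FOR EVERY PRIME `p` (K2(p) lane, SLICE C, first
# general-`p` kill: the `(p, p−1)` C∞ / light-pair class; file-holder res-dim4-p-5 g5)

[OURS · counted 0 · cell `res-dim4-pi` · K2(p) lane, slice C (general-`p` programme after K2(5); bus plan res-dim4-p-5 g5 2026-08-29
08:09Z) · seat p-5 g5.]  Nothing here proves K2(p) for any `p`, `NoIsolatedTrap p p` or resolution of singularities in dimension ≥ 4 /
characteristic `p` — NOT proved; what is proved is the emptiness of ONE class of OUR frame's hypothetical infinite chains, for every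
prime `p` (at `p = 5` it is res-dim4-p-3 g4's `no_light_pair_tail_four_five`, p707288; beyond `p = 5` the light pair and the D∞-type
classes do NOT exhaust slice C).  AI kernel work, weaker than expert review.

THE CLASS.  A witnessed isolated above-floor `Step0 p` chain with `x^{r₀} ∣ F₀`, constant shade `d < p` and `e_G ≡ 2` from `k₀`, whose
boundary is a LIGHT PAIR from `k₀`: all weights `≤ 1`, `|r| = 2` (then `ord₀ = d + 2 = p + 1`, so `d = p − 1`: the C∞ class of the
weight game VMG(p, p−1)).  THE ROUTE (every ingredient general `p`):
* ENTRY — FT `exists_satellite_ge p` gives a satellite step `k ≥ k₀`; the child `c (k+2)` has boundary pair `{j k, j (k+1)}` and is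
  TT for it (res-dim4-p-5 g5 `tt_of_satellite`, p707227 §1: the kernel line `V_k ∩ H_{j k}` is the satellite direction); clean by
  `FrameChange.deletePthPowers_step_F`; so res-dim4-typ-1 g4's `SwapTransport.pairInv_refl p` starts the invariant with `π = 1`;
* CHAIN — res-dim4-p-5 g5's Inv-agnostic `pair_virtual_chain p` fed by res-dim4-typ-1 g4's `SwapTransport.pair_virtual_step p`
  (canonical transport, coherent precision family, every prime): an honest witnessed isolated above-floor chain of constant shade
  `d`, `e_G ≡ 2`, charts in the pair, virtual weights = real weights ∘ π;
* KILL — the virtual chain is again a light pair, hence LOSS-FREE (`lossfree_of_light_pair_step`: the non-chart pair letter keeps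
  weight `1`, so it is untranslated; free letters weigh `0`), and loss-free constant-`(d < p, e_G = 2)` tails are empty by
  res-dim4-p-5 g3's C13 `no_lossfree_tail p` (p684130).
* **`no_light_pair_tail_prime (p)`** — THE THEOREM; `lightPair_entry` — the entry package; `lossfree_of_light_pair_step` — the bookkeeping;
* **`eventually_heavy_prime (p)`** — hence (res-dim4-p-5 g5 `weights_dichotomy_prime`, `…ResConePrimeWeights`) every constant-shade-`(p−1)`
  `e_G = 2` tail has, from some `k₁` on, a letter of weight `≥ 2` at every state: the `(p, p−1)` slice-C residual is the HEAVY class.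
[cite: CossartJannsenSaito2020, Thm. 3.10(4), Thm. 3.14, Lemma 13.2, Thm. 13.7] [cite: Hauser2010, §§F–G (chart expressions of a point blowup; cleaning)]
bears_on: LADDER-RESOLUTION:D157-DOOR2 (res-dim4-pi · K2(p) = `RidgeBudget.NoAboveFloorTrap p p` · slice C, general-`p` light pair).
Supports stmt-ResolutionOfSingularities-16155 (helper).
-/

set_option linter.dupNamespace false -- mandated namespace of this single-conjunct summit

noncomputable section

namespace Summit.ResolutionOfSingularities.ResolutionOfSingularities.Theorems.PIDim4

namespace ResCone

open MvPolynomial Finset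
open Literature.AlgebraicGeometry.Resolution
open Literature.AlgebraicGeometry.Resolution.CentreBlowup
open Literature.AlgebraicGeometry.Resolution.Hauser2010
open Literature.AlgebraicGeometry.Resolution.HauserPerlega2019

variable {K : Type} [Field K] [DecidableEq K] (p : ℕ) [Fact p.Prime]

/-- **A LIGHT-PAIR STEP IN THE PAIR IS LOSS-FREE**: if `B.r = e_a + e_{a′}`, the step is charted at `ℓ ∈ {a, a′}` with `β ℓ = 0`, and
the child's boundary is again supported on `{a, a′}` with both weights `1`... precisely: if the child has weight `≥ 1` at the other pair
letter, then `β` vanishes on every boundary letter of `B`. [OURS · bookkeeping] [cite: HauserPerlega2019PRIMS, §2 (transform D′ of D)] -/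
theorem lossfree_of_light_pair_step (q : ℕ) {B : State K} {o : ℕ} (ho : ordZero B.F = o) {a a' ℓ : Fin 4}
    (hpair : ∀ i, i ≠ a → i ≠ a' → B.r i = 0) (hℓ : ℓ = a ∨ ℓ = a') {β : Fin 4 → K} (hβℓ : β ℓ = 0)
    (hchild : ∀ i, (i = a ∨ i = a') → i ≠ ℓ → 1 ≤ (CentreBlowup.step q Finset.univ ℓ β B).r i) :
    ∀ i, β i ≠ 0 → B.r i = 0 := by
  intro i hβi
  by_cases hia : i = a
  · subst hia
    have hiℓ : i ≠ ℓ := fun h => hβi (by rw [h]; exact hβℓ)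
    have h1 := hchild i (Or.inl rfl) hiℓ
    rw [step_r_univ' q ℓ β B ho, Finsupp.coe_update, Function.update_of_ne hiℓ, Finsupp.filter_apply, if_neg hβi] at h1
    omega
  · by_cases hia' : i = a'
    · subst hia'
      have hiℓ : i ≠ ℓ := fun h => hβi (by rw [h]; exact hβℓ)
      have h1 := hchild i (Or.inr rfl) hiℓ
      rw [step_r_univ' q ℓ β B ho, Finsupp.coe_update, Function.update_of_ne hiℓ, Finsupp.filter_apply, if_neg hβi] at h1
      omega
    · exact hpair i hia hia'

/-- **THE LIGHT-PAIR ENTRY PACKAGE, every prime `p`**: on a light-pair constant-`(d, e_G = 2)` tail there is, beyond `k₀`, a time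
`k + 2 ≥ 1` whose boundary is the pair `{j k, j (k+1)}` (both weights `1`, nothing else), TT for that pair, with `c (k+2)` clean —
after ANY satellite step `k ≥ k₀` (FT `exists_satellite_ge` + `tt_of_satellite`). [OURS]
[cite: CossartJannsenSaito2020, Thm. 3.10(4), Thm. 3.14, Thm. 9.3] -/
theorem lightPair_entry [CharP K p] {c : ℕ → State K} {j : ℕ → Fin 4} {b : ℕ → Fin 4 → K}
    (hc : ∀ k, IsIsolated p (c k).F ∧ Step0 p (c k) (c (k + 1))) (hw : FreeTail.IsWitnessedChain p c j b)
    (hr0 : ∀ e ∈ (c 0).F.support, (c 0).r ≤ e) (hfloor : ∀ k, ordZero (c k).F ≠ p) {k₀ d : ℕ}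
    (hshade : ∀ k, k₀ ≤ k → (c k).shade = (d : ℕ∞)) (he : ∀ k, k₀ ≤ k → Module.finrank K (resVertex (c k)) = 2)
    (hwt : ∀ k, k₀ ≤ k → (∀ i, (c k).r i ≤ 1) ∧ (c k).r.degree = 2) :
    ∃ k, k₀ ≤ k ∧ j k ≠ j (k + 1) ∧ (c (k + 2)).r (j k) = 1 ∧ (c (k + 2)).r (j (k + 1)) = 1 ∧
      (∀ i, i ≠ j k → i ≠ j (k + 1) → (c (k + 2)).r i = 0) ∧
      (∀ v ∈ resVertex (c (k + 2)), v (j k) = 0 → v (j (k + 1)) = 0 → v = 0) ∧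
      deletePthPowers p (c (k + 2)).F = (c (k + 2)).F := by
  obtain ⟨k, hk, hsat⟩ := exists_satellite_ge p hc hw k₀
  have hstep : ∀ k, c (k + 1) = CentreBlowup.step p Finset.univ (j k) (b k) (c k) := fun k => (hw k).2.2.2.2
  -- new weights are `o − p ≥ 1`, and `≤ 1` in the light pair
  have hnew : ∀ m, k₀ ≤ m → (c (m + 1)).r (j m) = 1 := by
    intro m hm
    obtain ⟨o, ho, hpo, -⟩ := chain_band p hc hfloor m
    have h := (hwt (m + 1) (by omega)).1 (j m)
    rw [hstep m, step_r_univ' p (j m) (b m) (c m) ho, Finsupp.coe_update, Function.update_self] at h ⊢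
    omega
  have h1 : (c (k + 2)).r (j (k + 1)) = 1 := hnew (k + 1) (by omega)
  have h2 : (c (k + 2)).r (j k) = 1 := by
    obtain ⟨o, ho, -, -⟩ := chain_band p hc hfloor (k + 1)
    have h := hnew k hk
    rw [hstep (k + 1), step_r_univ' p (j (k + 1)) (b (k + 1)) (c (k + 1)) ho, Finsupp.coe_update,
      Function.update_of_ne hsat.1.symm, Finsupp.filter_apply, if_pos hsat.2]
    exact h
  refine ⟨k, hk, hsat.1.symm, h2, h1, ?_, tt_of_satellite p hc hw hr0 hfloor hshade he hk hsat, ?_⟩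
  · exact apply_eq_zero_of_degree_eq ((c (k + 2)).r) hsat.1.symm (by rw [(hwt (k + 2) (by omega)).2, h2, h1])
  · rw [hstep (k + 1)]
    exact FrameChange.deletePthPowers_step_F p Finset.univ (j (k + 1)) (b (k + 1)) (c (k + 1))

/-- **THE LIGHT-PAIR `e_G = 2` TAIL IS EMPTY, FOR EVERY PRIME `p`.**  Over a field of characteristic `p`, no witnessed isolated
above-floor `Step0 p` chain with `x^{r₀} ∣ F₀` has, from some `k₀` on, constant shade `d < p`, `e_G ≡ 2`, and a light-pair boundary
(all weights `≤ 1`, `|r| = 2`).  Route: `lightPair_entry` → `SwapTransport.pairInv_refl` → `pair_virtual_chain` with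
`SwapTransport.pair_virtual_step` → loss-free (`lossfree_of_light_pair_step`) → C13 `no_lossfree_tail`. [OURS]
[cite: CossartJannsenSaito2020, Thm. 3.10(4), Thm. 3.14, Lemma 13.2, Thm. 13.7] [cite: Hauser2010, §§F–G (chart expressions of a point blowup; cleaning)] -/
theorem no_light_pair_tail_prime [CharP K p] {c : ℕ → State K} {j : ℕ → Fin 4} {b : ℕ → Fin 4 → K}
    (hc : ∀ k, IsIsolated p (c k).F ∧ Step0 p (c k) (c (k + 1))) (hw : FreeTail.IsWitnessedChain p c j b)
    (hr0 : ∀ e ∈ (c 0).F.support, (c 0).r ≤ e) (hfloor : ∀ k, ordZero (c k).F ≠ p) {k₀ d : ℕ} (hdp : d < p)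
    (hshade : ∀ k, k₀ ≤ k → (c k).shade = (d : ℕ∞)) (he : ∀ k, k₀ ≤ k → Module.finrank K (resVertex (c k)) = 2)
    (hwt : ∀ k, k₀ ≤ k → (∀ i, (c k).r i ≤ 1) ∧ (c k).r.degree = 2) : False := by
  have hstep : ∀ k, c (k + 1) = CentreBlowup.step p Finset.univ (j k) (b k) (c k) := fun k => (hw k).2.2.2.2
  have hdivk : ∀ k, ∀ e ∈ (c k).F.support, (c k).r ≤ e := IsolatedBand.isolated_chain_forall_le hc hr0
  have hord : ∀ m, k₀ ≤ m → ordZero (c m).F = (((c m).r.degree + d : ℕ) : ℕ∞) ∧ p < (c m).r.degree + d := by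
    intro m hm
    obtain ⟨o, ho, hpo, -, hod⟩ := chain_shade_nat p hc hfloor hshade hm
    have h2 := (hwt m hm).2
    refine ⟨?_, by omega⟩
    rw [ho]; congr 1; omega
  -- (1) entry
  obtain ⟨k, hk, hjj, hra, hra', hoth, hTT, hclean⟩ := lightPair_entry p hc hw hr0 hfloor hshade he hwt
  set a : Fin 4 := j k with ha
  set a' : Fin 4 := j (k + 1) with ha'
  have hentry := SwapTransport.pairInv_refl p hjj hclean (hdivk (k + 2)) hoth (hc (k + 2)).1 (he (k + 2) (by omega)) hTT
  -- (2) the virtual chain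
  obtain ⟨c', j', b', -, hInv, hc', hw', hr0', hfloor', hshade', he', hletters, hpass⟩ :=
    pair_virtual_chain (K := K) p (d := d) (a := a) (a' := a') (B₀ := c (k + 2))
      (Inv := fun t B => ∃ π : Equiv.Perm (Fin 4), (B.r = Finsupp.mapDomain (Equiv.symm π) (c (k + 2 + t)).r ∧
        (∀ i, i ≠ a → i ≠ a' → B.r i = 0) ∧ ordZero B.F = ordZero (c (k + 2 + t)).F ∧ B.shade = (c (k + 2 + t)).shade ∧
        (∀ d ∈ B.F.support, B.r ≤ d) ∧ IsIsolated p B.F ∧ Module.finrank K (ResCone.resVertex B) = 2 ∧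
        (∀ v ∈ ResCone.resVertex B, v a = 0 → v a' = 0 → v = 0) ∧
        ∃ (Θ e : ℕ → Fin 4 → MvPolynomial (Fin 4) K), (∀ M k, Θ (M + 1) k - Θ M k ∈ originIdeal K ^ (M + 2)) ∧
          ∀ M, (∀ k, constantCoeff (Θ M k) = 0) ∧
            (∀ i, B.r i ≠ 0 → Θ M (π i) = X i * e M i ∧ constantCoeff (e M i) ≠ 0) ∧
            IsUnit (Matrix.det (Matrix.of fun k m => coeff (Finsupp.single m 1) (Θ M k))) ∧
            ∃ U E : MvPolynomial (Fin 4) K, constantCoeff U ≠ 0 ∧ E ∈ originIdeal K ^ M ∧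
              B.F = deletePthPowers p (U ^ p * aeval (Θ M) (c (k + 2 + t)).F) + E))
      ⟨1, hentry⟩
      (fun t B hB => by
        obtain ⟨π, hr, hpairB, hoB, -, hdivB, hisoB, heB, -, -⟩ := hB
        have hkt : k₀ ≤ k + 2 + t := by omega
        obtain ⟨ho, hpo⟩ := hord (k + 2 + t) hkt
        refine ⟨hisoB, ?_, ?_, heB, hpairB, hdivB⟩
        · rw [hoB, ho, hr, Finsupp.degree_mapDomain]
        · rw [hr, Finsupp.degree_mapDomain]; exact hpo)
      (fun t B hB => by
        obtain ⟨π, hinv⟩ := hB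
        have hkt : k₀ ≤ k + 2 + t := by omega
        have hkt1 : k₀ ≤ k + 2 + t + 1 := by omega
        obtain ⟨o, ho, hpo, ho2⟩ := chain_band p hc hfloor (k + 2 + t)
        obtain ⟨o', ho', hpo', ho2'⟩ := chain_band p hc hfloor (k + 2 + t + 1)
        have hsh : (c (k + 2 + t + 1)).shade = (c (k + 2 + t)).shade := by rw [hshade _ hkt1, hshade _ hkt]
        obtain ⟨ℓ, β, π', hℓ, hβ, hinv'⟩ := SwapTransport.pair_virtual_step p hjj (c (k + 2 + t)) (c (k + 2 + t + 1)) B π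
          (j (k + 2 + t)) (b (k + 2 + t)) (hw (k + 2 + t)).2.1 (hstep (k + 2 + t)) (hdivk _) (hdivk _) ⟨o, ho, hpo, ho2⟩
          ⟨o', ho', hpo', ho2'⟩ hsh (hc (k + 2 + t + 1)).1 (he _ hkt1) hinv
        exact ⟨ℓ, β, hℓ, hβ, π', hinv'⟩)
  -- (3) the virtual chain is a light pair, hence loss-free
  have hstep' : ∀ t, c' (t + 1) = CentreBlowup.step p Finset.univ (j' t) (b' t) (c' t) := fun t => (hw' t).2.2.2.2
  have hlight' : ∀ t, (∀ i, (c' t).r i ≤ 1) ∧ (c' t).r.degree = 2 := by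
    intro t
    obtain ⟨π, hr, -⟩ := hInv t
    have hw2 := hwt (k + 2 + t) (by omega)
    refine ⟨fun i => ?_, ?_⟩
    · rw [hr, Finsupp.mapDomain_equiv_apply, Equiv.symm_symm]; exact hw2.1 _
    · rw [hr, Finsupp.degree_mapDomain]; exact hw2.2
  have hone' : ∀ t, (c' t).r a = 1 ∧ (c' t).r a' = 1 := by
    intro t
    obtain ⟨hw1, hdeg⟩ := hlight' t
    have hz := hpass t (Nat.zero_le _)
    have hsum := degree_eq_add_of_forall_ne (f := (c' t).r) hjj hz
    have ha1 := hw1 a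
    have ha'1 := hw1 a'
    omega
  have hloss : ∀ t, 0 ≤ t → ∀ i, b' t i ≠ 0 → (c' t).r i = 0 := by
    intro t _
    obtain ⟨o, ho⟩ : ∃ o : ℕ, ordZero (c' t).F = o := by
      obtain ⟨π, -, -, hoB, -⟩ := hInv t
      obtain ⟨o, ho, -⟩ := chain_band p hc hfloor (k + 2 + t)
      exact ⟨o, by rw [hoB, ho]⟩
    refine lossfree_of_light_pair_step p (B := c' t) ho (hpass t (Nat.zero_le _)) (hletters t (Nat.zero_le _))
      (hw' t).2.1 fun i hi _ => ?_
    rw [← hstep' t]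
    rcases hi with rfl | rfl
    · exact (hone' (t + 1)).1.ge
    · exact (hone' (t + 1)).2.ge
  exact no_lossfree_tail p hc' hw' hr0' hfloor' hdp (k₀ := 0) hshade' he' hloss

/-- **EVERY `(p, p−1)` BINARY-CONE TAIL IS EVENTUALLY HEAVY.**  On a witnessed isolated above-floor `Step0 p` chain with `x^{r₀} ∣ F₀`,
constant shade `p − 1` and `e_G ≡ 2` from `k₀`, from some `k₁ ≥ k₀` on every state has a boundary letter of weight `≥ 2`
(`weights_dichotomy_prime`, the light branch being empty by `no_light_pair_tail_prime`). [OURS]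
[cite: CossartJannsenSaito2020, Thm. 3.10(4), Thm. 3.14, Lemma 13.2, Thm. 13.7] -/
theorem eventually_heavy_prime [CharP K p] {c : ℕ → State K} {j : ℕ → Fin 4} {b : ℕ → Fin 4 → K}
    (hc : ∀ k, IsIsolated p (c k).F ∧ Step0 p (c k) (c (k + 1))) (hw : FreeTail.IsWitnessedChain p c j b)
    (hr0 : ∀ e ∈ (c 0).F.support, (c 0).r ≤ e) (hfloor : ∀ k, ordZero (c k).F ≠ p) {k₀ d : ℕ} (hd : d + 1 = p)
    (hshade : ∀ k, k₀ ≤ k → (c k).shade = (d : ℕ∞)) (he : ∀ k, k₀ ≤ k → Module.finrank K (resVertex (c k)) = 2) :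
    ∃ k₁, k₀ ≤ k₁ ∧ ∀ k, k₁ ≤ k → ∃ W, 2 ≤ (c k).r W := by
  rcases weights_dichotomy_prime p hc hw hr0 hfloor hd hshade with hL | hH
  · exact (no_light_pair_tail_prime p hc hw hr0 hfloor (by omega) hshade he hL).elim
  · exact hH

end ResCone

end Summit.ResolutionOfSingularities.ResolutionOfSingularities.Theorems.PIDim4

end
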